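import Summits.FinalStateConjecture.FinalStateConjecture.Theorems.EIHFluxBalanceInertialRecessionVirialHot

/-!
# Route EIHFluxBalance — crux `InertialRecession`, abstract endgame: a CLEAR group is cold or linearly extended forever

Helper file for `stmt-FinalStateConjecture-10166` (virial route, `InertialRecession_endgame_generalN_virial.md` §7b/§8); Mathlib-only,
literal hypotheses of `stub_pairwiseDichotomy`. The group version of `…VirialHot.cold_or_extended`, in the form the top-down induction
on clear groups consumes: for a group `𝒦` (`|𝒦| ≥ 2`) that is LINEARLY ISOLATED (outsiders `≥ σt`) and CONFINED AT ONE LINEAR SCALE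
(diameter `≤ (min((κ−κ²)/2, σ/2)/2)·t`, so that the window `(ξ_{x₀}(t), min(…)t)` is admissible forever):
`tendsto_charges_of_clear_class` (the class charges converge — the proof of `tendsto_charges_of_isolated_class` uses confinement
at this single scale only) and `cold_or_extended_of_clear` (EITHER all member velocities converge to ONE vector OR two members are
at distance `≥ b·t` at EVERY late time; virial inequality for the `1`-gapped root `𝒦`, `eventually_linear_of_grid`).
-/

noncomputable section

open Finset Filter Topology MeasureTheory intervalIntegral

namespace Summit.FinalStateConjecture.FinalStateConjecture.Theorems.SublinearIsFree.Virial

open Literature.Geometry.Lorentzian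

variable {N : ℕ}

/-- **Charges of a linearly isolated class confined at one linear scale converge** (window `(ξ_{x₀}(t), c₁t)`,
`c₁ = min((κ−κ²)/2, σ/2)`, `ρ = √t`, `δ = 1/2`; same proof as `tendsto_charges_of_isolated_class`). [folklore] -/
theorem tendsto_charges_of_clear_class (M : Fin N → ℝ) (ξ v : Fin N → ℝ → E3) (κ : ℝ)
    (P : ℝ → E3 → ℝ → Fin 4 → ℝ) (hκ0 : 0 < κ) (hκ1 : κ < 1)
    (hξ : ∀ i, ContDiff ℝ ((⊤ : ℕ∞) : WithTop ℕ∞) (ξ i))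
    (hcone : ∀ i, ∀ᶠ t in atTop, ‖ξ i t‖ ≤ κ ^ 2 * t)
    (hk : ∃ k : ℝ, 0 ≤ k ∧ k < 1 ∧ ∀ i t, ‖v i t‖ ≤ k)
    (hslave : ∀ i, Tendsto (fun t ↦ deriv (ξ i) t - v i t) atTop (𝓝 0))
    (hWL : ∀ ρ : ℝ → ℝ, Tendsto ρ atTop atTop → ∀ δ : ℝ, 0 < δ → δ < 1 → ∃ (C T : ℝ),
      ∀ (t₁ t₂ : ℝ) (c : ℝ → E3) (R : ℝ → ℝ), T ≤ t₁ → t₁ ≤ t₂ →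
      (∀ s ∈ Set.Icc t₁ t₂, ∀ s' ∈ Set.Icc t₁ t₂, ‖c s - c s'‖ ≤ 2 * |s - s'| ∧ |R s - R s'| ≤ 2 * |s - s'|) →
      (∀ s ∈ Set.Icc t₁ t₂, ρ s ≤ δ * R s ∧ ‖c s‖ + R s ≤ (κ + κ ^ 2) / 2 * s ∧
        ∀ j, ‖ξ j s - c s‖ ≤ (1 - δ) * R s ∨ (1 + δ) * R s ≤ ‖ξ j s - c s‖) →
      ∀ μ : Fin 4, |P t₂ (c t₂) (R t₂) μ - P t₁ (c t₁) (R t₁) μ| ≤ C * ∫ s in t₁..t₂, (R s ^ (3 / 2 : ℝ))⁻¹)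
    (hID : ∀ ρ : ℝ → ℝ, Tendsto ρ atTop atTop → ∀ δ : ℝ, 0 < δ → δ < 1 → ∃ (T : ℝ) (ζ : ℝ → ℝ),
      Tendsto ζ atTop (𝓝 0) ∧ ∀ (t : ℝ) (c : E3) (R : ℝ) (A : Finset (Fin N)), T ≤ t → ρ t ≤ δ * R →
      ‖c‖ + R ≤ (κ + κ ^ 2) / 2 * t → (∀ j, ‖ξ j t - c‖ ≤ (1 - δ) * R ∨ (1 + δ) * R ≤ ‖ξ j t - c‖) →
      (∀ j, j ∈ A ↔ ‖ξ j t - c‖ ≤ (1 - δ) * R) →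
      |P t c R 0 - ∑ j ∈ A, M j * (√(1 - ‖v j t‖ ^ 2))⁻¹| ≤ ζ t ∧
      ∀ k : Fin 3, |P t c R k.succ - ∑ j ∈ A, M j * (√(1 - ‖v j t‖ ^ 2))⁻¹ * v j t k| ≤ ζ t)
    (𝒦 : Finset (Fin N)) {x₀ : Fin N} (hx₀ : x₀ ∈ 𝒦) {σ : ℝ} (hσ : 0 < σ)
    (hiso : ∀ᶠ t in atTop, ∀ x ∈ 𝒦, ∀ z ∉ 𝒦, σ * t ≤ ‖ξ z t - ξ x t‖)
    (hconf₁ : ∀ᶠ t in atTop, ∀ x ∈ 𝒦, ∀ y ∈ 𝒦, ‖ξ x t - ξ y t‖ ≤ min ((κ - κ ^ 2) / 2) (σ / 2) / 2 * t) :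
    ∃ (Einf : ℝ) (Pinf : E3), Tendsto (fun t ↦ ∑ j ∈ 𝒦, M j * (√(1 - ‖v j t‖ ^ 2))⁻¹) atTop (𝓝 Einf) ∧
      Tendsto (fun t ↦ ∑ j ∈ 𝒦, (M j * (√(1 - ‖v j t‖ ^ 2))⁻¹) • v j t) atTop (𝓝 Pinf) := by
  obtain ⟨k, -, hk1, hvk⟩ := hk
  -- constants of the root window
  set c₁ : ℝ := min ((κ - κ ^ 2) / 2) (σ / 2) with hc₁
  have hκκ : 0 < κ - κ ^ 2 := by nlinarith
  have hc₁pos : 0 < c₁ := lt_min (by linarith) (by linarith)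
  have hc₁le : c₁ ≤ (κ - κ ^ 2) / 2 := min_le_left _ _
  have hc₁σ : c₁ ≤ σ / 2 := min_le_right _ _
  have hc₁two : c₁ ≤ 2 := by
    have : (κ - κ ^ 2) / 2 ≤ 2 := by nlinarith
    exact hc₁le.trans this
  -- the window law and identification at threshold `ρ = √t`, clearance `δ = 1/2`
  have hρ : Tendsto (fun t : ℝ ↦ √t) atTop atTop := by
    have := tendsto_rpow_atTop (show (0 : ℝ) < 1 / 2 by norm_num)
    refine this.congr' ?_
    filter_upwards [eventually_ge_atTop 0] with t ht
    rw [Real.sqrt_eq_rpow]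
  obtain ⟨C, T_W, hW⟩ := hWL (fun t ↦ √t) hρ (1 / 2) (by norm_num) (by norm_num)
  obtain ⟨T_I, ζ, hζ, hI⟩ := hID (fun t ↦ √t) hρ (1 / 2) (by norm_num) (by norm_num)
  -- eventual facts, turned into thresholds
  have hdiff : Differentiable ℝ (ξ x₀) := (hξ x₀).differentiable (by simp)
  have hev_speed : ∀ᶠ t in atTop, ‖deriv (ξ x₀) t‖ ≤ 2 := by
    have h1 : ∀ᶠ t in atTop, ‖deriv (ξ x₀) t - v x₀ t‖ < 1 := by
      have := (tendsto_iff_norm_sub_tendsto_zero.mp (hslave x₀))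
      simp only [sub_zero] at this
      exact this.eventually (gt_mem_nhds (by norm_num))
    filter_upwards [h1] with t ht
    calc ‖deriv (ξ x₀) t‖ = ‖(deriv (ξ x₀) t - v x₀ t) + v x₀ t‖ := by rw [sub_add_cancel]
      _ ≤ ‖deriv (ξ x₀) t - v x₀ t‖ + ‖v x₀ t‖ := norm_add_le _ _
      _ ≤ 1 + k := by linarith [hvk x₀ t, ht.le]
      _ ≤ 2 := by linarith
  have hev_sqrt : ∀ᶠ t : ℝ in atTop, √t ≤ 1 / 2 * (c₁ * t) := by
    filter_upwards [eventually_ge_atTop (4 / c₁ ^ 2), eventually_ge_atTop (0 : ℝ)] with t ht ht0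
    have hc2 : 0 < c₁ ^ 2 := by positivity
    have ht' : 4 ≤ c₁ ^ 2 * t := by
      have := (div_le_iff₀ hc2).mp ht
      linarith
    have hy : 0 ≤ 1 / 2 * (c₁ * t) := by positivity
    have hle : t ≤ (1 / 2 * (c₁ * t)) ^ 2 := by nlinarith
    calc √t ≤ √((1 / 2 * (c₁ * t)) ^ 2) := Real.sqrt_le_sqrt hle
      _ = 1 / 2 * (c₁ * t) := Real.sqrt_sq hy
  have hev_conf : ∀ᶠ t in atTop, ∀ x ∈ 𝒦, ∀ y ∈ 𝒦, ‖ξ x t - ξ y t‖ ≤ c₁ / 2 * t := hconf₁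
  obtain ⟨T₀, hT₀⟩ := eventually_atTop.mp (((((hcone x₀).and hev_speed).and hev_sqrt).and hiso).and hev_conf)
  -- the master threshold
  set T : ℝ := max (max (max T₀ T_W) T_I) 1 with hTdef
  have hT0 : T₀ ≤ T := ((le_max_left _ _).trans (le_max_left _ _)).trans (le_max_left _ _)
  have hTW : T_W ≤ T := ((le_max_right _ _).trans (le_max_left _ _)).trans (le_max_left _ _)
  have hTI : T_I ≤ T := (le_max_right _ _).trans (le_max_left _ _)
  have hT1 : 1 ≤ T := le_max_right _ _
  have hTpos : 0 < T := one_pos.trans_le hT1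
  have hfacts : ∀ t, T ≤ t → ‖ξ x₀ t‖ ≤ κ ^ 2 * t ∧ ‖deriv (ξ x₀) t‖ ≤ 2 ∧ √t ≤ 1 / 2 * (c₁ * t) ∧
      (∀ x ∈ 𝒦, ∀ z ∉ 𝒦, σ * t ≤ ‖ξ z t - ξ x t‖) ∧ (∀ x ∈ 𝒦, ∀ y ∈ 𝒦, ‖ξ x t - ξ y t‖ ≤ c₁ / 2 * t) :=
    fun t ht ↦ by
    obtain ⟨⟨⟨⟨h1, h2⟩, h3⟩, h4⟩, h5⟩ := hT₀ t (hT0.trans ht)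
    exact ⟨h1, h2, h3, h4, h5⟩
  -- admissibility of the root window `(ξ x₀ t, c₁ t)` at every `t ≥ T`
  have hadm : ∀ t, T ≤ t → √t ≤ 1 / 2 * (c₁ * t) ∧ ‖ξ x₀ t‖ + c₁ * t ≤ (κ + κ ^ 2) / 2 * t ∧
      ∀ j, ‖ξ j t - ξ x₀ t‖ ≤ (1 - 1 / 2) * (c₁ * t) ∨ (1 + 1 / 2) * (c₁ * t) ≤ ‖ξ j t - ξ x₀ t‖ := by
    intro t ht
    obtain ⟨hc, -, hs, hiso', hconf'⟩ := hfacts t ht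
    have htpos : 0 < t := hTpos.trans_le ht
    refine ⟨hs, ?_, fun j ↦ ?_⟩
    · have : c₁ * t ≤ (κ - κ ^ 2) / 2 * t := mul_le_mul_of_nonneg_right hc₁le htpos.le
      linarith
    · by_cases hj : j ∈ 𝒦
      · left
        have := hconf' j hj x₀ hx₀
        linarith
      · right
        have h1 : (1 + 1 / 2) * (c₁ * t) ≤ σ * t := by
          have h2 : c₁ * t ≤ σ / 2 * t := mul_le_mul_of_nonneg_right hc₁σ htpos.le
          have h3 : 0 ≤ σ * t := (mul_pos hσ htpos).le
          nlinarith
        exact h1.trans (hiso' x₀ hx₀ j hj)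
  -- the charge along the window path and the window law along it
  set Q : ℝ → Fin 4 → ℝ := fun t μ ↦ P t (ξ x₀ t) (c₁ * t) μ with hQ
  have hlaw : ∀ t₁ t₂, T ≤ t₁ → t₁ ≤ t₂ → ∀ μ, |Q t₂ μ - Q t₁ μ| ≤
      C * ∫ s in t₁..t₂, ((c₁ * s) ^ (3 / 2 : ℝ))⁻¹ := by
    intro t₁ t₂ ht₁ h12 μ
    refine hW t₁ t₂ (ξ x₀) (fun s ↦ c₁ * s) (hTW.trans ht₁) h12 (fun s hs s' hs' ↦ ⟨?_, ?_⟩) ?_ μ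
    · exact Endgame.lipschitz_two_of_deriv hdiff (fun t ht ↦ (hfacts t ht).2.1) (ht₁.trans hs.1) (ht₁.trans hs'.1)
    · rw [← mul_sub, abs_mul, abs_of_pos hc₁pos]
      exact mul_le_mul_of_nonneg_right hc₁two (abs_nonneg _)
    · intro s hs
      exact hadm s (ht₁.trans hs.1)
  have hconv : ∀ μ, ∃ L : ℝ, Tendsto (fun t ↦ Q t μ) atTop (𝓝 L) :=
    Endgame.exists_tendsto_charge_of_linear_scale (R := fun s ↦ c₁ * s) hTpos hc₁pos
      ((continuous_const.mul continuous_id).continuousOn) (fun s _ ↦ le_rfl) hlaw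
  -- identification with the class `𝒦`
  have hmem : ∀ t, T ≤ t → ∀ j, j ∈ 𝒦 ↔ ‖ξ j t - ξ x₀ t‖ ≤ (1 - 1 / 2) * (c₁ * t) := by
    intro t ht j
    obtain ⟨-, -, -, hiso', hconf'⟩ := hfacts t ht
    have htpos : 0 < t := hTpos.trans_le ht
    constructor
    · intro hj
      have := hconf' j hj x₀ hx₀
      linarith
    · intro hle
      by_contra hj
      have h1 := hiso' x₀ hx₀ j hj
      have h2 : c₁ * t ≤ σ / 2 * t := mul_le_mul_of_nonneg_right hc₁σ htpos.le
      have h3 : 0 < σ * t := mul_pos hσ htpos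
      linarith
  have hid : ∀ t, T ≤ t → |Q t 0 - ∑ j ∈ 𝒦, M j * (√(1 - ‖v j t‖ ^ 2))⁻¹| ≤ ζ t ∧
      ∀ kk : Fin 3, |Q t kk.succ - ∑ j ∈ 𝒦, M j * (√(1 - ‖v j t‖ ^ 2))⁻¹ * v j t kk| ≤ ζ t := by
    intro t ht
    obtain ⟨hs, hcone', hclear⟩ := hadm t ht
    have h := hI t (ξ x₀ t) (c₁ * t) 𝒦 (hTI.trans ht) hs hcone' hclear (hmem t ht)
    simpa [hQ] using h
  choose L hL using hconv
  have hE : Tendsto (fun t ↦ ∑ j ∈ 𝒦, M j * (√(1 - ‖v j t‖ ^ 2))⁻¹) atTop (𝓝 (L 0)) :=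
    Endgame.tendsto_of_abs_sub_le_of_tendsto (hL 0) hζ fun t ht ↦ (hid t ht).1
  have hPk : ∀ i : Fin 3, Tendsto (fun t ↦ ∑ j ∈ 𝒦, M j * (√(1 - ‖v j t‖ ^ 2))⁻¹ * v j t i) atTop (𝓝 (L i.succ)) :=
    fun i ↦ Endgame.tendsto_of_abs_sub_le_of_tendsto (hL i.succ) hζ fun t ht ↦ (hid t ht).2 i
  let Pinf : E3 := WithLp.toLp 2 fun i ↦ L i.succ
  refine ⟨L 0, Pinf, hE, Endgame.tendsto_euclidean_of_forall_apply fun i ↦ ?_⟩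
  have h1 : (fun t ↦ (∑ j ∈ 𝒦, (M j * (√(1 - ‖v j t‖ ^ 2))⁻¹) • v j t) i) =
      fun t ↦ ∑ j ∈ 𝒦, M j * (√(1 - ‖v j t‖ ^ 2))⁻¹ * v j t i := by
    ext t
    simp only [WithLp.ofLp_sum, Finset.sum_apply, PiLp.smul_apply, smul_eq_mul]
  rw [h1]
  simpa [Pinf] using hPk i


/-- **A CLEAR GROUP IS COLD OR LINEARLY EXTENDED FOREVER.** For `𝒦` (`|𝒦| ≥ 2`) linearly isolated (`≥ σt`) and confined at
the single scale `min((κ−κ²)/2, σ/2)/2`: either all member velocities converge to ONE vector, or there is `b > 0` with two members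
at distance `≥ b·t` at EVERY late time (`K → K∞ ≥ 0` by `tendsto_charges_of_clear_class`; `K∞ = 0`: cold limit; `K∞ > 0`:
`internalEnergy_le'`, `virial_inequality_of_windows` for the `1`-gapped root `𝒦`, `eventually_linear_of_grid`). [folklore] -/
theorem cold_or_extended_of_clear (M : Fin N → ℝ) (ξ v : Fin N → ℝ → E3) (κ : ℝ)
    (P : ℝ → E3 → ℝ → Fin 4 → ℝ) (hM : ∀ i, 0 < M i) (hκ0 : 0 < κ) (hκ1 : κ < 1)
    (hξ : ∀ i, ContDiff ℝ ((⊤ : ℕ∞) : WithTop ℕ∞) (ξ i))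
    (hcone : ∀ i, ∀ᶠ t in atTop, ‖ξ i t‖ ≤ κ ^ 2 * t)
    (hsep : ∀ i j, i ≠ j → Tendsto (fun t ↦ ‖ξ i t - ξ j t‖) atTop atTop) (hvc : ∀ i, Continuous (v i))
    (hk : ∃ k : ℝ, 0 ≤ k ∧ k < 1 ∧ ∀ i t, ‖v i t‖ ≤ k)
    (hslave : ∀ i, Tendsto (fun t ↦ deriv (ξ i) t - v i t) atTop (𝓝 0))
    (hWL : ∀ ρ : ℝ → ℝ, Tendsto ρ atTop atTop → ∀ δ : ℝ, 0 < δ → δ < 1 → ∃ (C T : ℝ),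
      ∀ (t₁ t₂ : ℝ) (c : ℝ → E3) (R : ℝ → ℝ), T ≤ t₁ → t₁ ≤ t₂ →
      (∀ s ∈ Set.Icc t₁ t₂, ∀ s' ∈ Set.Icc t₁ t₂, ‖c s - c s'‖ ≤ 2 * |s - s'| ∧ |R s - R s'| ≤ 2 * |s - s'|) →
      (∀ s ∈ Set.Icc t₁ t₂, ρ s ≤ δ * R s ∧ ‖c s‖ + R s ≤ (κ + κ ^ 2) / 2 * s ∧
        ∀ j, ‖ξ j s - c s‖ ≤ (1 - δ) * R s ∨ (1 + δ) * R s ≤ ‖ξ j s - c s‖) →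
      ∀ μ : Fin 4, |P t₂ (c t₂) (R t₂) μ - P t₁ (c t₁) (R t₁) μ| ≤ C * ∫ s in t₁..t₂, (R s ^ (3 / 2 : ℝ))⁻¹)
    (hID : ∀ ρ : ℝ → ℝ, Tendsto ρ atTop atTop → ∀ δ : ℝ, 0 < δ → δ < 1 → ∃ (T : ℝ) (ζ : ℝ → ℝ),
      Tendsto ζ atTop (𝓝 0) ∧ ∀ (t : ℝ) (c : E3) (R : ℝ) (A : Finset (Fin N)), T ≤ t → ρ t ≤ δ * R →
      ‖c‖ + R ≤ (κ + κ ^ 2) / 2 * t → (∀ j, ‖ξ j t - c‖ ≤ (1 - δ) * R ∨ (1 + δ) * R ≤ ‖ξ j t - c‖) →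
      (∀ j, j ∈ A ↔ ‖ξ j t - c‖ ≤ (1 - δ) * R) →
      |P t c R 0 - ∑ j ∈ A, M j * (√(1 - ‖v j t‖ ^ 2))⁻¹| ≤ ζ t ∧
      ∀ k : Fin 3, |P t c R k.succ - ∑ j ∈ A, M j * (√(1 - ‖v j t‖ ^ 2))⁻¹ * v j t k| ≤ ζ t)
    (𝒦 : Finset (Fin N)) (h𝒦 : 2 ≤ 𝒦.card) {σ : ℝ} (hσ : 0 < σ)
    (hiso : ∀ᶠ t in atTop, ∀ x ∈ 𝒦, ∀ z ∉ 𝒦, σ * t ≤ ‖ξ z t - ξ x t‖)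
    (hconf₁ : ∀ᶠ t in atTop, ∀ x ∈ 𝒦, ∀ y ∈ 𝒦, ‖ξ x t - ξ y t‖ ≤ min ((κ - κ ^ 2) / 2) (σ / 2) / 2 * t) :
    (∃ V : E3, ∀ j ∈ 𝒦, Tendsto (v j) atTop (𝓝 V)) ∨
      ∃ b : ℝ, 0 < b ∧ ∀ᶠ t in atTop, ∃ i ∈ 𝒦, ∃ j ∈ 𝒦, b * t ≤ ‖ξ i t - ξ j t‖ := by
  classical
  obtain ⟨k, hk0, hk1, hvk⟩ := id hk
  have hk2 : 0 < 1 - k ^ 2 := by nlinarith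
  have hv1 : ∀ i t, ‖v i t‖ < 1 := fun i t ↦ (hvk i t).trans_lt hk1
  obtain ⟨x₀, hx₀⟩ : 𝒦.Nonempty := Finset.card_pos.mp (by omega)
  have hne : 𝒦.Nonempty := ⟨x₀, hx₀⟩
  have hMK : 0 < ∑ i ∈ 𝒦, M i := Finset.sum_pos (fun i _ ↦ hM i) hne
  have hΓ : ∀ i t, (√(1 - ‖v i t‖ ^ 2))⁻¹ ≤ (√(1 - k ^ 2))⁻¹ := fun i t ↦ by
    refine inv_anti₀ (Real.sqrt_pos.mpr hk2) (Real.sqrt_le_sqrt ?_)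
    nlinarith only [hvk i t, norm_nonneg (v i t), hk0]
  -- the class charges converge, hence `K → K∞ ≥ 0`
  obtain ⟨Einf, Pinf, hE, hP⟩ :=
    tendsto_charges_of_clear_class M ξ v κ P hκ0 hκ1 hξ hcone hk hslave hWL hID 𝒦 hx₀ hσ hiso hconf₁
  set Kinf : ℝ := Einf - √((∑ i ∈ 𝒦, M i) ^ 2 + ‖Pinf‖ ^ 2) with hKinf
  have hKt : Tendsto (fun t ↦ ∑ j ∈ 𝒦, M j * (√(1 - ‖v j t‖ ^ 2))⁻¹ -
      √((∑ i ∈ 𝒦, M i) ^ 2 + ‖∑ i ∈ 𝒦, (M i * (√(1 - ‖v i t‖ ^ 2))⁻¹) • v i t‖ ^ 2)) atTop (𝓝 Kinf) :=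
    hE.sub (((hP.norm.pow 2).const_add _).sqrt)
  have hKinf0 : 0 ≤ Kinf :=
    ge_of_tendsto' hKt fun t ↦ internalEnergy_nonneg 𝒦 M (fun j ↦ v j t) (fun i _ ↦ hM i) hne fun i _ ↦ hv1 i t
  rcases hKinf0.eq_or_lt with hK0 | hKpos
  · left
    rw [← hK0] at hKt
    exact ⟨(√((∑ i ∈ 𝒦, M i) ^ 2 + ‖Pinf‖ ^ 2))⁻¹ • Pinf, fun j hj ↦
      tendsto_velocity_of_internalEnergy_tendsto_zero' 𝒦 M v (fun i _ ↦ hM i) hk0 hk1 (fun i _ t ↦ hvk i t) hP hKt hj⟩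
  right
  -- the virial inequality for the `1`-gapped root `𝒦`
  have hκκ : 0 < κ - κ ^ 2 := by nlinarith
  have hc₁ : 0 < min ((κ - κ ^ 2) / 2) (σ / 2) := lt_min (by positivity) (by positivity)
  have hroot : ∀ᶠ t in atTop, ∃ D G : ℝ, (∀ x ∈ 𝒦, ∀ y ∈ 𝒦, ‖ξ x t - ξ y t‖ ≤ D) ∧
      (∀ x ∈ 𝒦, ∀ z ∈ univ \ 𝒦, G ≤ ‖ξ x t - ξ z t‖) ∧ 1 * D < G := by
    filter_upwards [hiso, hconf₁, eventually_gt_atTop 0] with t hi hc ht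
    refine ⟨min ((κ - κ ^ 2) / 2) (σ / 2) / 2 * t, σ * t, hc, fun x hx z hz ↦ ?_, ?_⟩
    · rw [norm_sub_rev]; exact hi x hx z (Finset.mem_sdiff.mp hz).2
    · have h1 : min ((κ - κ ^ 2) / 2) (σ / 2) / 2 * t ≤ σ / 2 / 2 * t :=
        mul_le_mul_of_nonneg_right (by linarith only [min_le_right ((κ - κ ^ 2) / 2) (σ / 2)]) ht.le
      have h2 : 0 < σ * t := mul_pos hσ ht
      linarith only [h1, h2]
  obtain ⟨h, CJ, T₂, ε, hh, hCJ, hεa, hεt, hvir⟩ :=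
    virial_inequality_of_windows M ξ v κ P hM hκ0 hκ1 hξ hcone hsep hvc hk hslave hWL hID 𝒦 h𝒦 hroot
  clear hWL hID hroot hsep hcone hiso hconf₁
  -- the diameter and the lever bound `|G| ≤ A·diam`
  have hne2 : (𝒦 ×ˢ 𝒦).Nonempty := hne.product hne
  obtain ⟨diam, hdiam⟩ : ∃ d : ℝ → ℝ, ∀ t, d t = (𝒦 ×ˢ 𝒦).sup' hne2 (fun p ↦ ‖ξ p.1 t - ξ p.2 t‖) :=
    ⟨_, fun _ ↦ rfl⟩
  have hdle : ∀ t, ∀ x ∈ 𝒦, ∀ y ∈ 𝒦, ‖ξ x t - ξ y t‖ ≤ diam t := fun t x hx y hy ↦ by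
    rw [hdiam]
    exact Finset.le_sup' (fun p : Fin N × Fin N ↦ ‖ξ p.1 t - ξ p.2 t‖) (b := (x, y)) (Finset.mem_product.mpr ⟨hx, hy⟩)
  have hd0 : ∀ t, 0 ≤ diam t := fun t ↦ (norm_nonneg _).trans (hdle t x₀ hx₀ x₀ hx₀)
  have hdex : ∀ t, ∃ i ∈ 𝒦, ∃ j ∈ 𝒦, diam t = ‖ξ i t - ξ j t‖ := fun t ↦ by
    obtain ⟨p, hp, hpeq⟩ := Finset.exists_mem_eq_sup' hne2 (fun p : Fin N × Fin N ↦ ‖ξ p.1 t - ξ p.2 t‖)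
    exact ⟨p.1, (Finset.mem_product.mp hp).1, p.2, (Finset.mem_product.mp hp).2, by rw [hdiam, hpeq]⟩
  obtain ⟨A, hAdef⟩ : ∃ A : ℝ, A = max 1 ((∑ i ∈ 𝒦, M i) * (√(1 - k ^ 2))⁻¹) := ⟨_, rfl⟩
  have hA1 : 1 ≤ A := hAdef ▸ le_max_left _ _
  have hAΓ : (∑ i ∈ 𝒦, M i) * (√(1 - k ^ 2))⁻¹ ≤ A := hAdef ▸ le_max_right _ _
  have hA0 : 0 < A := one_pos.trans_le hA1
  obtain ⟨G, hGdef⟩ : ∃ G : ℝ → ℝ, ∀ t, G t = ∑ j ∈ 𝒦, inner ℝ ((M j * (√(1 - ‖v j t‖ ^ 2))⁻¹) • v j t)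
      (ξ j t - (∑ l ∈ 𝒦, M l)⁻¹ • ∑ l ∈ 𝒦, M l • ξ l t) := ⟨_, fun _ ↦ rfl⟩
  obtain ⟨σ₂, hσdef⟩ : ∃ σ₂ : ℝ → ℝ, ∀ t, σ₂ t = ∑ j ∈ 𝒦, ∑ l ∈ 𝒦, M j * M l * ‖v j t - v l t‖ ^ 2 :=
    ⟨_, fun _ ↦ rfl⟩
  have hσc : Continuous σ₂ := by
    rw [show σ₂ = fun t ↦ ∑ j ∈ 𝒦, ∑ l ∈ 𝒦, M j * M l * ‖v j t - v l t‖ ^ 2 from funext hσdef]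
    exact continuous_finsetSum _ fun j _ ↦ continuous_finsetSum _ fun l _ ↦
      continuous_const.mul (((hvc j).sub (hvc l)).norm.pow 2)
  have hGle : ∀ t, |G t| ≤ A * diam t := by
    intro t
    rw [hGdef]
    refine (Finset.abs_sum_le_sum_abs _ _).trans ?_
    have hterm : ∀ j ∈ 𝒦, |inner ℝ ((M j * (√(1 - ‖v j t‖ ^ 2))⁻¹) • v j t)
        (ξ j t - (∑ l ∈ 𝒦, M l)⁻¹ • ∑ l ∈ 𝒦, M l • ξ l t)| ≤ M j * (√(1 - k ^ 2))⁻¹ * diam t := by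
      intro j hj
      refine (abs_real_inner_le_norm _ _).trans ?_
      have hγ0 : 0 < (√(1 - ‖v j t‖ ^ 2))⁻¹ :=
        inv_pos.mpr (Real.sqrt_pos.mpr (by nlinarith only [hv1 j t, norm_nonneg (v j t)]))
      have h1 : ‖(M j * (√(1 - ‖v j t‖ ^ 2))⁻¹) • v j t‖ ≤ M j * (√(1 - k ^ 2))⁻¹ := by
        rw [norm_smul, Real.norm_eq_abs, abs_of_pos (mul_pos (hM j) hγ0)]
        calc M j * (√(1 - ‖v j t‖ ^ 2))⁻¹ * ‖v j t‖ ≤ M j * (√(1 - ‖v j t‖ ^ 2))⁻¹ * 1 :=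
              mul_le_mul_of_nonneg_left (hv1 j t).le (mul_pos (hM j) hγ0).le
          _ ≤ M j * (√(1 - k ^ 2))⁻¹ := by
              rw [mul_one]; exact mul_le_mul_of_nonneg_left (hΓ j t) (hM j).le
      have h2 : ‖ξ j t - (∑ l ∈ 𝒦, M l)⁻¹ • ∑ l ∈ 𝒦, M l • ξ l t‖ ≤ diam t :=
        norm_sub_centre_le (ξ := fun i ↦ ξ i t) (M := M) (S := 𝒦) (A := 𝒦) hM subset_rfl hne hj (hdle t)
      exact mul_le_mul h1 h2 (norm_nonneg _) (mul_pos (hM j) (inv_pos.mpr (Real.sqrt_pos.mpr hk2))).le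
    refine (Finset.sum_le_sum hterm).trans ?_
    rw [← Finset.sum_mul, ← Finset.sum_mul]
    exact mul_le_mul_of_nonneg_right hAΓ (hd0 t)
  -- constants
  set CK : ℝ := 2 * ((√(1 - k ^ 2))⁻¹) ^ 8 / ∑ i ∈ 𝒦, M i with hCKdef
  have hCK0 : 0 < CK := by positivity
  set c : ℝ := (2 * ∑ i ∈ 𝒦, M i)⁻¹ with hcdef
  have hc0 : 0 < c := by positivity
  set q : ℝ := Kinf / (2 * CK) with hqdef
  have hq0 : 0 < q := by positivity
  have hev_σ : ∀ᶠ t in atTop, q ≤ σ₂ t := by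
    have hK2 : ∀ᶠ t in atTop, Kinf / 2 < ∑ j ∈ 𝒦, M j * (√(1 - ‖v j t‖ ^ 2))⁻¹ -
        √((∑ i ∈ 𝒦, M i) ^ 2 + ‖∑ i ∈ 𝒦, (M i * (√(1 - ‖v i t‖ ^ 2))⁻¹) • v i t‖ ^ 2) :=
      hKt.eventually (lt_mem_nhds (by linarith only [hKpos]))
    filter_upwards [hK2] with t ht
    have hle : ∑ j ∈ 𝒦, M j * (√(1 - ‖v j t‖ ^ 2))⁻¹ -
        √((∑ i ∈ 𝒦, M i) ^ 2 + ‖∑ i ∈ 𝒦, (M i * (√(1 - ‖v i t‖ ^ 2))⁻¹) • v i t‖ ^ 2) ≤ CK * σ₂ t := by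
      rw [hσdef]
      exact internalEnergy_le' 𝒦 M (fun j ↦ v j t) (fun i _ ↦ hM i) hk1 (fun i _ ↦ hvk i t) hne
    rw [hqdef, div_le_iff₀ (by positivity)]
    linarith only [ht, hle]
  have hev_ε : ∀ᶠ t in atTop, ε t ≤ c * q / 2 :=
    (hεt.eventually (gt_mem_nhds (show (0:ℝ) < c * q / 2 by positivity))).mono fun t ht ↦ ht.le
  obtain ⟨T_M, hTM⟩ := exists_forall_norm_sub_le_sub_of_slaved' (ξ := ξ) (v := v)
    (fun i ↦ (hξ i).differentiable (by simp)) hk hslave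
  obtain ⟨T₃, hT₃⟩ := eventually_atTop.mp (hev_σ.and hev_ε)
  set T : ℝ := max (max (max T₂ T₃) T_M) 1 with hTdef
  have hT2 : T₂ ≤ T := ((le_max_left _ _).trans (le_max_left _ _)).trans (le_max_left _ _)
  have hT3 : T₃ ≤ T := ((le_max_right _ _).trans (le_max_left _ _)).trans (le_max_left _ _)
  have hTM' : T_M ≤ T := (le_max_right _ _).trans (le_max_left _ _)
  have hT1 : 1 ≤ T := le_max_right _ _
  have hTpos : 0 < T := one_pos.trans_le hT1
  have hgrid : ∀ n : ℕ, c * q / 2 * (n * h) - A * diam T ≤ (A + CJ) * diam (T + n * h) := by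
    intro n
    have hv := hvir T hT2 n (diam (T + n * h)) (hd0 _) (hdle _)
    rw [← hGdef (T + n * h), ← hGdef T] at hv
    have hσ : (∫ s in T..(T + n * h), ∑ j ∈ 𝒦, ∑ l ∈ 𝒦, M j * M l * ‖v j s - v l s‖ ^ 2) =
        ∫ s in T..(T + n * h), σ₂ s := by simp only [hσdef]
    rw [hσ] at hv
    have hnh : 0 ≤ (n : ℝ) * h := by positivity
    have hle : T ≤ T + n * h := le_add_of_nonneg_right hnh
    have hσint : q * (n * h) ≤ ∫ s in T..(T + n * h), σ₂ s := by
      have h1 : ∫ _ in T..(T + n * h), q = q * (n * h) := by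
        rw [intervalIntegral.integral_const, smul_eq_mul]; ring
      rw [← h1]
      refine intervalIntegral.integral_mono_on hle (by simp) (hσc.intervalIntegrable _ _) fun s hs ↦ ?_
      exact (hT₃ s (hT3.trans hs.1)).1
    have hεint : (∫ s in T..(T + n * h), ε s) ≤ c * q / 2 * (n * h) := by
      have h1 : ∫ _ in T..(T + n * h), c * q / 2 = c * q / 2 * (n * h) := by
        rw [intervalIntegral.integral_const, smul_eq_mul]; ring
      rw [← h1]
      refine intervalIntegral.integral_mono_on hle hεa.intervalIntegrable (by simp) fun s hs ↦ ?_
      exact (hT₃ s (hT3.trans hs.1)).2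
    have hG1 := (abs_le.mp (hGle (T + n * h))).2
    have hG2 := (abs_le.mp (hGle T)).1
    have hcσ : c * (q * (n * h)) ≤ c * ∫ s in T..(T + n * h), σ₂ s := mul_le_mul_of_nonneg_left hσint hc0.le
    linarith only [hv, hcσ, hεint, hG1, hG2]
  have hACJ : 0 < A + CJ := by linarith only [hA0, hCJ]
  have hlip : ∀ s t, T ≤ s → s ≤ t → diam s ≤ diam t + 2 * (t - s) := by
    intro s t hs hst
    have hmove : |diam s - diam t| ≤ 2 * (t - s) := by
      rw [hdiam, hdiam]
      refine abs_sup'_dist_sub_le hne2 (fun i ↦ ξ i s) (fun i ↦ ξ i t) fun p _ ↦ ⟨?_, ?_⟩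
      · rw [norm_sub_rev]; exact hTM p.1 _ _ (hTM'.trans hs) hst
      · rw [norm_sub_rev]; exact hTM p.2 _ _ (hTM'.trans hs) hst
    linarith only [(abs_le.mp hmove).2]
  have hev := eventually_linear_of_grid (f := diam) hh (show 0 < c * q / 2 by positivity) hACJ hTpos.le hgrid hlip
  refine ⟨c * q / 2 / (4 * (A + CJ)), by positivity, ?_⟩
  filter_upwards [hev] with t ht
  obtain ⟨i, hi, j, hj, hij⟩ := hdex t
  exact ⟨i, hi, j, hj, hij ▸ ht⟩

/-- Registered one-line form of `cold_or_extended_of_clear`. [folklore] -/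
theorem cold_or_extended_of_clear' : open Literature.Geometry.Lorentzian Filter Topology Finset MeasureTheory intervalIntegral in ∀ {N : ℕ} (M : Fin N → ℝ) (ξ v : Fin N → ℝ → E3) (κ : ℝ) (P : ℝ → E3 → ℝ → Fin 4 → ℝ) (hM : ∀ i, 0 < M i) (hκ0 : 0 < κ) (hκ1 : κ < 1) (hξ : ∀ i, ContDiff ℝ ((⊤ : ℕ∞) : WithTop ℕ∞) (ξ i)) (hcone : ∀ i, ∀ᶠ t in atTop, ‖ξ i t‖ ≤ κ ^ 2 * t) (hsep : ∀ i j, i ≠ j → Tendsto (fun t ↦ ‖ξ i t - ξ j t‖) atTop atTop) (hvc : ∀ i, Continuous (v i)) (hk : ∃ k : ℝ, 0 ≤ k ∧ k < 1 ∧ ∀ i t, ‖v i t‖ ≤ k) (hslave : ∀ i, Tendsto (fun t ↦ deriv (ξ i) t - v i t) atTop (𝓝 0)) (hWL : ∀ ρ : ℝ → ℝ, Tendsto ρ atTop atTop → ∀ δ : ℝ, 0 < δ → δ < 1 → ∃ (C T : ℝ), ∀ (t₁ t₂ : ℝ) (c : ℝ → E3) (R : ℝ → ℝ), T ≤ t₁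 → t₁ ≤ t₂ → (∀ s ∈ Set.Icc t₁ t₂, ∀ s' ∈ Set.Icc t₁ t₂, ‖c s - c s'‖ ≤ 2 * |s - s'| ∧ |R s - R s'| ≤ 2 * |s - s'|) → (∀ s ∈ Set.Icc t₁ t₂, ρ s ≤ δ * R s ∧ ‖c s‖ + R s ≤ (κ + κ ^ 2) / 2 * s ∧ ∀ j, ‖ξ j s - c s‖ ≤ (1 - δ) * R s ∨ (1 + δ) * R s ≤ ‖ξ j s - c s‖) → ∀ μ : Fin 4, |P t₂ (c t₂) (R t₂) μ - P t₁ (c t₁) (R t₁) μ| ≤ C * ∫ s in t₁..t₂, (R s ^ (3 / 2 : ℝ))⁻¹) (hID : ∀ ρ : ℝ → ℝ, Tendsto ρ atTop atTop → ∀ δ : ℝ, 0 < δ → δ < 1 → ∃ (T : ℝ) (ζ : ℝ → ℝ), Tendsto ζ atTop (𝓝 0) ∧ ∀ (t : ℝ) (c : E3) (R : ℝ) (A : Finset (Fin N)), T ≤ t → ρ t ≤ δ * R → ‖c‖ + R ≤ (κ + κ ^ 2) / 2 * t → (∀ j, ‖ξ j t - c‖ ≤ (1 - δ) * R ∨ (1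 + δ) * R ≤ ‖ξ j t - c‖) → (∀ j, j ∈ A ↔ ‖ξ j t - c‖ ≤ (1 - δ) * R) → |P t c R 0 - ∑ j ∈ A, M j * (√(1 - ‖v j t‖ ^ 2))⁻¹| ≤ ζ t ∧ ∀ k : Fin 3, |P t c R k.succ - ∑ j ∈ A, M j * (√(1 - ‖v j t‖ ^ 2))⁻¹ * v j t k| ≤ ζ t) (𝒦 : Finset (Fin N)) (h𝒦 : 2 ≤ 𝒦.card) {σ : ℝ} (hσ : 0 < σ) (hiso : ∀ᶠ t in atTop, ∀ x ∈ 𝒦, ∀ z ∉ 𝒦, σ * t ≤ ‖ξ z t - ξ x t‖) (hconf₁ : ∀ᶠ t in atTop, ∀ x ∈ 𝒦, ∀ y ∈ 𝒦, ‖ξ x t - ξ y t‖ ≤ min ((κ - κ ^ 2) / 2) (σ / 2) / 2 * t), (∃ V : E3, ∀ j ∈ 𝒦, Tendsto (v j) atTop (𝓝 V)) ∨ ∃ b : ℝ, 0 < b ∧ ∀ᶠ t in atTop, ∃ i ∈ 𝒦, ∃ j ∈ 𝒦, b * t ≤ ‖ξ i t - ξ j t‖ :=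
  fun M ξ v κ P hM hκ0 hκ1 hξ hcone hsep hvc hk hslave hWL hID 𝒦 h𝒦 _ hσ hiso hconf₁ ↦
    cold_or_extended_of_clear M ξ v κ P hM hκ0 hκ1 hξ hcone hsep hvc hk hslave hWL hID 𝒦 h𝒦 hσ hiso hconf₁

end Summit.FinalStateConjecture.FinalStateConjecture.Theorems.SublinearIsFree.Virial

end
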